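import Mathlib.Analysis.CStarAlgebra.Matrix
import Literature.MathematicalPhysics.QuantumFieldTheory.LatticeGaugeDobrushin
import HarnessLib

/-!
# Shen–Zhu–Zhu from the one-link Poincaré inequality on `SU(N)`

Fourth file of the Dobrushin route to the named fact
`Literature.MathematicalPhysics.QuantumFieldTheory.shen_zhu_zhu` (Shen–Zhu–Zhu, CMP 400 (2023)
805, Thm. 1.2 and Cor. 1.6 "Mass gap": uniqueness and exponential clustering of 't Hooft-scaled `SU(N)`
lattice Yang–Mills for `|β| < 1/(16(d-1))`). `LatticeGaugeDobrushin.lean` reduced `shen_zhu_zhu`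
to Dobrushin's condition in the Vasserstein form for the one-link conditional laws
(`shen_zhu_zhu_of_dobrushinCondition`). This file proves that condition from a single functional
inequality on the single group `SU(N)` — the Poincaré inequality for Gibbs-tilted Haar measures
`ν_B(dg) ∝ exp(N Re tr(g B)) dg`, `‖B‖_op < 1/2`, with the Bakry–Émery constant
`K_B = N(1/2 - ‖B‖_op)` — and so reduces `shen_zhu_zhu` to it (`shen_zhu_zhu_of_haarPoincare`).
Everything on the lattice side, and everything about how the one-link law depends on the
neighbouring links, is proved here; the constants come out exactly as Shen–Zhu–Zhu's
Assumption 1.1 (`K_𝒮 = N/2 - 8(d-1)N|β| > 0`), with no slack.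

* `abs_integral_tilted_add_sub_le` — **the perturbation lemma** (pure measure theory): if all
  interpolating tilts `μ^{f + t w}`, `t ∈ [0,1]`, satisfy `Var(ψ) ≤ Lip_r(ψ)²/K`, then
  `|∫ φ dμ^{f+w} - ∫ φ dμ^{f}| ≤ Lip_r(φ) Lip_r(w) / K` (discrete interpolation
  `μ^{f+(t+h)w} = (μ^{f+tw})^{hw}`, one step `= Cov(φ, e^{hw}) / 𝔼 e^{hw}`, covariance by AM–GM from
  the two variances, `n` steps cost `e^{2‖w‖∞/n}`, `n → ∞`). This is the Kantorovich–Rubinstein form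
  of `W₁(μ^f, μ^{f+w}) ≤ ‖∇w‖∞/K`.
* `frobNorm`, `matrixOpNorm` — the Hilbert–Schmidt and `ℓ²`-operator norms written instance-free
  (they are the norms of Mathlib's non-instance `Matrix.frobeniusNormedAddCommGroup` /
  `Matrix.instL2OpNormedAddCommGroup`), unitary invariance of `‖·‖_F`, the Cauchy–Schwarz bound
  `|Re tr(A B)| ≤ ‖A‖_F ‖B‖_F`, `‖U‖_op = 1`.
* `staple`, `re_trace_holonomy_update`, `wilsonBoundaryAction_singleton_update` — **the Wilson
  action is affine in each link**: `Re tr ρ(U_p(ω^{x←g})) = Re tr(ρ(g) ρ(T_p^x(ω)))` with the staple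
  `T_p^x(ω) ∈ G` (four positions of `x` on `p`; any unitary `ρ`), hence
  `S_{x}(ω^{x←g}) = ∑_{p ∋ x} (N - Re tr(ρ(g) ρ(T_p^x(ω))))`.
* `siteLaw_ymSpecification_thooft` — for `SU(N)` at bare coupling `N β` the one-link conditional
  law is `ν_{B_ω}`, `B_ω = β ∑_{p ∋ x} T_p^x(ω)` (`stapleField`), with `‖B_ω‖_op ≤ 2(d-1)|β|`
  (`matrixOpNorm_stapleField_le`) and `‖B_ω - B_η‖_F ≤ |β| n(x,y) ‖ω_y - η_y‖_F` when `ω = η`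
  off `y` (`frobNorm_stapleField_sub_le`; `n(x,y)` = `linkInfluence`, with
  `∑_y n(x,y) ≤ 6(d-1)` = `sum_linkInfluence_le`).
* `shen_zhu_zhu_of_haarPoincare` — **the reduction**: the one-link Poincaré hypothesis implies
  `shen_zhu_zhu d N`, via the perturbation lemma (one-link KR contraction with coefficient
  `κ_β n(x,y)`, `κ_β = |β|/(1/2 - 2(d-1)|β|)`, `N` cancels), `6(d-1)κ_β < 1 ⟺ |β| < 1/(16(d-1))`,
  and `shen_zhu_zhu_of_dobrushinCondition` with the Frobenius distance as Dobrushin weight.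

What remains of `shen_zhu_zhu` after this file is the hypothesis `hLP` alone: the Poincaré
inequality `Var_{ν_B}(ψ) ≤ M²/(N(1/2 - ‖B‖_op))` for `M`-Lipschitz (Frobenius distance) `ψ` on
`SU(N)`. It follows from: `Ric_{SU(N)} = N/2` for the Hilbert–Schmidt bi-invariant metric
(Shen–Zhu–Zhu (4.8), `α = 2`; Anderson–Guionnet–Zeitouni (F.6)), the one-link Hessian bound
`|Hess(N Re tr(g B))(X,X)| ≤ N ‖B‖_op |X|²` (the `e = ē` part of Shen–Zhu–Zhu Lemma 4.1), the
Bakry–Émery criterion `CD(K,∞) ⇒ Poincaré(1/K)` (Bakry–Émery 1985; Bakry–Gentil–Ledoux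
Prop. 4.8.1; Shen–Zhu–Zhu (4.7) ⇒ Cor. 4.4 (4.11)), and `|∇ψ| ≤ Lip_geodesic(ψ) ≤ Lip_Frobenius(ψ)` (chords are
shorter than arcs) — Riemannian analysis on `SU(N)` that Mathlib does not have yet.

## References

* H. Shen, R. Zhu, X. Zhu, *A stochastic analysis approach to lattice Yang–Mills at strong
  coupling*, CMP 400 (2023) 805–851, arXiv:2204.12737 — numbers and pages of arXiv v1 (the only arXiv
  version; the CMP numbering was not checked): Assumption 1.1 (p. 4), Thm. 1.2, Rem. 1.3 (p. 5) and the
  unnumbered remark following it (Dobrushin route, p. 6), Cor. 1.6 "Mass gap" (p. 7), §2 (2.3)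
  (Hilbert–Schmidt metric, p. 10), Lemma 4.1 (Hessian bound, p. 17), (4.7) (Bakry–Émery condition) and
  (4.8) (Ricci curvature, after [AGZ10, (F.6)]) with Cor. 4.4 (4.11) (Poincaré inequality on `Λ_L`),
  p. 19.
* D. Bakry, M. Émery, *Diffusions hypercontractives*, Sém. Probab. XIX, LNM 1123 (1985) 177–206.
* D. Bakry, I. Gentil, M. Ledoux, *Analysis and Geometry of Markov Diffusion Operators*,
  Grundlehren 348 (2014), §4.8, Prop. 4.8.1.
* G. W. Anderson, A. Guionnet, O. Zeitouni, *An Introduction to Random Matrices*, CUP (2010),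
  Appendix F, (F.6) and Lemma F.27.
* H. Föllmer, *Random fields and diffusion processes*, LNM 1362 (1988), Ch. I §2 (Dobrushin's
  contraction technique in the Vasserstein form).
* R. L. Dobrushin, Theory Probab. Appl. 15 (1970) 458–486.
-/

noncomputable section

open MeasureTheory Filter Topology ProbabilityTheory Function Real
open scoped NNReal Matrix
open Literature.Probability.LatticeModels
open Literature.Probability.LatticeModels.DobrushinMetric
open Literature.MathematicalPhysics.QuantumLattice

namespace Literature.MathematicalPhysics.QuantumFieldTheory

/-! ### The perturbation lemma: Kantorovich–Rubinstein closeness of tilts from a uniform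
Poincaré (variance) bound along the interpolating tilt family -/

section TiltPerturbation

variable {S : Type*} [MeasurableSpace S]

/-- `exp` is `e^c`-Lipschitz on `(-∞, c]`. [folklore] -/
theorem abs_exp_sub_exp_le_of_le {x y c : ℝ} (hx : x ≤ c) (hy : y ≤ c) :
    |exp x - exp y| ≤ exp c * |x - y| := by
  wlog hxy : y ≤ x generalizing x y
  · rw [abs_sub_comm, abs_sub_comm x y]
    exact this hy hx (le_of_not_ge hxy)
  rw [abs_of_nonneg (sub_nonneg.2 (exp_le_exp.2 hxy)), abs_of_nonneg (sub_nonneg.2 hxy)]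
  have hyx : y = x + -(x - y) := by ring
  have h1 : exp x - exp y = exp x * (1 - exp (-(x - y))) := by
    rw [mul_sub, mul_one, ← exp_add, ← hyx]
  have h2 : 1 - exp (-(x - y)) ≤ x - y := by
    have := add_one_le_exp (-(x - y))
    linarith
  calc exp x - exp y = exp x * (1 - exp (-(x - y))) := h1
    _ ≤ exp x * (x - y) := mul_le_mul_of_nonneg_left h2 (exp_pos x).le
    _ ≤ exp c * (x - y) := mul_le_mul_of_nonneg_right (exp_le_exp.2 hx) (sub_nonneg.2 hxy)

/-- Bounded measurable real functions are integrable against finite measures. [folklore] -/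
theorem integrable_of_measurable_of_abs_le {ν : Measure S} [IsFiniteMeasure ν] {f : S → ℝ}
    (hf : Measurable f) {C : ℝ} (hC : ∀ s, |f s| ≤ C) : Integrable f ν :=
  Integrable.of_bound hf.aestronglyMeasurable C (ae_of_all _ fun s => by
    rw [Real.norm_eq_abs]; exact hC s)

/-- **One tilt step**: `∫ φ d(ν^g) - ∫ φ dν = Cov_ν(φ, e^g) / ν(e^g)` for the tilted measure
`ν^g = e^g ν / ν(e^g)`. [folklore] -/
theorem integral_tilted_sub_integral_eq {ν : Measure S} [IsProbabilityMeasure ν] {φ g : S → ℝ}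
    (hg : Integrable (fun s => exp (g s)) ν) :
    ∫ s, φ s ∂ν.tilted g - ∫ s, φ s ∂ν =
      (∫ s, exp (g s) * φ s ∂ν - (∫ s, exp (g s) ∂ν) * ∫ s, φ s ∂ν) / ∫ s, exp (g s) ∂ν := by
  have hZ : 0 < ∫ s, exp (g s) ∂ν := integral_exp_pos hg
  rw [integral_tilted]
  simp_rw [smul_eq_mul]
  have : ∫ s, exp (g s) / (∫ x, exp (g x) ∂ν) * φ s ∂ν =
      (∫ s, exp (g s) * φ s ∂ν) / ∫ x, exp (g x) ∂ν := by
    simp_rw [div_mul_eq_mul_div]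
    exact integral_div _ _
  rw [this, eq_div_iff hZ.ne', sub_mul, div_mul_cancel₀ _ hZ.ne']
  ring

/-- Pointwise AM–GM: `2|ab| ≤ s a² + b²/s` for `s > 0`. [folklore] -/
theorem two_mul_abs_mul_le {s : ℝ} (hs : 0 < s) (a b : ℝ) :
    2 * |a * b| ≤ s * a ^ 2 + b ^ 2 / s := by
  have h0 : 0 ≤ (s * |a| - |b|) ^ 2 / s := by positivity
  have h1 : (s * |a| - |b|) ^ 2 / s = s * |a| ^ 2 + |b| ^ 2 / s - 2 * (|a| * |b|) := by
    field_simp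
    ring
  rw [abs_mul, ← sq_abs a, ← sq_abs b]
  linarith

/-- **Covariances from variances** (Cauchy–Schwarz in AM–GM form): on a probability space, if
`Var f ≤ L²/K` and `Var g ≤ M²/K` for bounded measurable `f, g`, then `|Cov(f, g)| ≤ L M / K`.
[folklore] -/
theorem abs_integral_mul_sub_le_of_variance_le {ν : Measure S} [IsProbabilityMeasure ν]
    {f g : S → ℝ} {K L M : ℝ} (hK : 0 < K) (hL : 0 ≤ L) (hM : 0 ≤ M)
    (hfm : Measurable f) (hfb : ∃ C, ∀ s, |f s| ≤ C) (hgm : Measurable g)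
    (hgb : ∃ C, ∀ s, |g s| ≤ C)
    (hfV : ∫ s, (f s - ∫ s', f s' ∂ν) ^ 2 ∂ν ≤ L ^ 2 / K)
    (hgV : ∫ s, (g s - ∫ s', g s' ∂ν) ^ 2 ∂ν ≤ M ^ 2 / K) :
    |∫ s, f s * g s ∂ν - (∫ s, f s ∂ν) * ∫ s, g s ∂ν| ≤ L * M / K := by
  obtain ⟨Cf, hCf⟩ := hfb
  obtain ⟨Cg, hCg⟩ := hgb
  set mf : ℝ := ∫ s, f s ∂ν with hmf
  set mg : ℝ := ∫ s, g s ∂ν with hmg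
  have hfi : Integrable f ν := integrable_of_measurable_of_abs_le hfm hCf
  have hgi : Integrable g ν := integrable_of_measurable_of_abs_le hgm hCg
  have hfgi : Integrable (fun s => f s * g s) ν :=
    integrable_of_measurable_of_abs_le (hfm.mul hgm) (C := Cf * Cg) fun s => by
      rw [abs_mul]
      exact mul_le_mul (hCf s) (hCg s) (abs_nonneg _) ((abs_nonneg _).trans (hCf s))
  have hFm : Measurable fun s => f s - mf := hfm.sub_const _
  have hGm : Measurable fun s => g s - mg := hgm.sub_const _
  have hFb : ∀ s, |f s - mf| ≤ Cf + |mf| := fun s =>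
    (abs_sub _ _).trans (add_le_add (hCf s) le_rfl)
  have hGb : ∀ s, |g s - mg| ≤ Cg + |mg| := fun s =>
    (abs_sub _ _).trans (add_le_add (hCg s) le_rfl)
  have hFGi : Integrable (fun s => (f s - mf) * (g s - mg)) ν :=
    integrable_of_measurable_of_abs_le (hFm.mul hGm) (C := (Cf + |mf|) * (Cg + |mg|)) fun s => by
      rw [abs_mul]
      exact mul_le_mul (hFb s) (hGb s) (abs_nonneg _) ((abs_nonneg _).trans (hFb s))
  have hF2i : Integrable (fun s => (f s - mf) ^ 2) ν :=
    integrable_of_measurable_of_abs_le (hFm.pow_const 2) (C := (Cf + |mf|) ^ 2) fun s => by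
      rw [abs_pow]; exact pow_le_pow_left₀ (abs_nonneg _) (hFb s) 2
  have hG2i : Integrable (fun s => (g s - mg) ^ 2) ν :=
    integrable_of_measurable_of_abs_le (hGm.pow_const 2) (C := (Cg + |mg|) ^ 2) fun s => by
      rw [abs_pow]; exact pow_le_pow_left₀ (abs_nonneg _) (hGb s) 2
  -- the covariance as a centred product
  have key : ∫ s, f s * g s ∂ν - mf * mg = ∫ s, (f s - mf) * (g s - mg) ∂ν := by
    have h : (fun s => (f s - mf) * (g s - mg)) =
        fun s => f s * g s - mg * f s - (mf * g s - mf * mg) := by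
      funext s; ring
    have i1 : Integrable (fun s => f s * g s - mg * f s) ν := hfgi.sub (hfi.const_mul mg)
    have i2 : Integrable (fun s => mf * g s - mf * mg) ν :=
      (hgi.const_mul mf).sub (integrable_const _)
    rw [h, integral_sub i1 i2, integral_sub hfgi (hfi.const_mul mg),
      integral_sub (hgi.const_mul mf) (integrable_const _), integral_const_mul, integral_const_mul,
      integral_const, probReal_univ, one_smul]
    ring
  rw [key]
  by_cases hL0 : L = 0
  · have hV0 : ∫ s, (f s - mf) ^ 2 ∂ν = 0 :=
      le_antisymm (by simpa [hL0] using hfV) (integral_nonneg fun s => sq_nonneg _)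
    have hae : (fun s => (f s - mf) ^ 2) =ᵐ[ν] 0 :=
      (integral_eq_zero_iff_of_nonneg (fun s => sq_nonneg _) hF2i).1 hV0
    have hae' : (fun s => (f s - mf) * (g s - mg)) =ᵐ[ν] 0 := hae.mono fun s hs => by
      have : f s - mf = 0 := pow_eq_zero_iff (n := 2) (by norm_num) |>.1 hs
      simp [this]
    rw [integral_congr_ae hae', hL0]
    simp
  by_cases hM0 : M = 0
  · have hV0 : ∫ s, (g s - mg) ^ 2 ∂ν = 0 :=
      le_antisymm (by simpa [hM0] using hgV) (integral_nonneg fun s => sq_nonneg _)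
    have hae : (fun s => (g s - mg) ^ 2) =ᵐ[ν] 0 :=
      (integral_eq_zero_iff_of_nonneg (fun s => sq_nonneg _) hG2i).1 hV0
    have hae' : (fun s => (f s - mf) * (g s - mg)) =ᵐ[ν] 0 := hae.mono fun s hs => by
      have : g s - mg = 0 := pow_eq_zero_iff (n := 2) (by norm_num) |>.1 hs
      simp [this]
    rw [integral_congr_ae hae', hM0]
    simp
  have hLpos : 0 < L := lt_of_le_of_ne hL (Ne.symm hL0)
  have hMpos : 0 < M := lt_of_le_of_ne hM (Ne.symm hM0)
  set s : ℝ := M / L with hs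
  have hspos : 0 < s := div_pos hMpos hLpos
  have hpt : ∀ x, |(f x - mf) * (g x - mg)| ≤ (s * (f x - mf) ^ 2 + (g x - mg) ^ 2 / s) / 2 :=
    fun x => by have := two_mul_abs_mul_le hspos (f x - mf) (g x - mg); linarith
  calc |∫ x, (f x - mf) * (g x - mg) ∂ν| ≤ ∫ x, |(f x - mf) * (g x - mg)| ∂ν :=
        abs_integral_le_integral_abs
    _ ≤ ∫ x, (s * (f x - mf) ^ 2 + (g x - mg) ^ 2 / s) / 2 ∂ν :=
        integral_mono hFGi.abs (((hF2i.const_mul s).add (hG2i.div_const s)).div_const 2) hpt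
    _ = (s * ∫ x, (f x - mf) ^ 2 ∂ν + (∫ x, (g x - mg) ^ 2 ∂ν) / s) / 2 := by
        rw [integral_div, integral_add (hF2i.const_mul s) (hG2i.div_const s), integral_const_mul,
          integral_div]
    _ ≤ (s * (L ^ 2 / K) + (M ^ 2 / K) / s) / 2 := by
        gcongr
    _ = L * M / K := by
        rw [hs]
        field_simp
        ring

/-- **The perturbation lemma** (the `W₁`-side of the Bakry–Émery/Dobrushin one-link estimate,
in Kantorovich–Rubinstein dual form). Let `μ` be a probability measure, `f, w` bounded measurable
potentials and `ν_t = μ^{f + t w}` (`Measure.tilted`) the interpolating tilts, `t ∈ [0, 1]`. If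
every `ν_t` satisfies the Poincaré-type variance bound `Var_{ν_t}(ψ) ≤ M²/K` for all bounded
measurable `ψ` with `|ψ(a) - ψ(b)| ≤ M r(a, b)`, and `w` itself satisfies
`|w(a) - w(b)| ≤ D r(a, b)`, then for every such `φ` (constant `L`)
`|∫ φ dν₁ - ∫ φ dν₀| ≤ L D / K`. Proof: `ν_{t+h} = (ν_t)^{h w}` (`tilted_tilted`), one step is
`Cov_{ν_t}(φ, e^{h w}) / ν_t(e^{h w})` with `e^{h w}` `h D e^{h‖w‖∞}`-Lipschitz and
`ν_t(e^{hw}) ≥ e^{-h‖w‖∞}`, so `n` steps of size `1/n` cost `L D e^{2‖w‖∞/n} / K`; let `n → ∞`.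
(This is the elementary form of `W₁(ν^{f}, ν^{f+w}) ≤ ‖∇w‖∞ / K` for `CD(K, ∞)` measures, e.g.
Bakry–Gentil–Ledoux, *Analysis and Geometry of Markov Diffusion Operators*, §4.8 with Prop. 4.8.1;
no Riemannian structure is used here: the curvature enters only through the hypothesis `hP`.)
[folklore] -/
theorem abs_integral_tilted_add_sub_le {μ : Measure S} [IsProbabilityMeasure μ]
    {r : S → S → ℝ} {f w φ : S → ℝ} {K L D B : ℝ}
    (hf : Measurable f) (hfb : ∃ C, ∀ s, |f s| ≤ C) (hw : Measurable w) (hwB : ∀ s, |w s| ≤ B)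
    (hφ : Measurable φ) (hφb : ∃ C, ∀ s, |φ s| ≤ C) (hK : 0 < K) (hL : 0 ≤ L) (hD : 0 ≤ D)
    (hφL : ∀ a b, |φ a - φ b| ≤ L * r a b) (hwD : ∀ a b, |w a - w b| ≤ D * r a b)
    (hP : ∀ t ∈ Set.Icc (0 : ℝ) 1, ∀ (ψ : S → ℝ) (M : ℝ), Measurable ψ → (∃ C, ∀ s, |ψ s| ≤ C) →
      0 ≤ M → (∀ a b, |ψ a - ψ b| ≤ M * r a b) →
      ∫ s, (ψ s - ∫ s', ψ s' ∂μ.tilted (fun u => f u + t * w u)) ^ 2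
          ∂μ.tilted (fun u => f u + t * w u) ≤ M ^ 2 / K) :
    |∫ s, φ s ∂μ.tilted (fun u => f u + w u) - ∫ s, φ s ∂μ.tilted f| ≤ L * D / K := by
  obtain ⟨Cf, hCf⟩ := hfb
  -- the tilt family
  set ν : ℝ → Measure S := fun t => μ.tilted (fun u => f u + t * w u) with hν
  have hmeas : ∀ t : ℝ, Measurable fun u => f u + t * w u := fun t => hf.add (hw.const_mul t)
  have hbdd : ∀ (t : ℝ) (u : S), |f u + t * w u| ≤ Cf + |t| * B := fun t u => by
    calc |f u + t * w u| ≤ |f u| + |t * w u| := abs_add_le _ _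
      _ ≤ Cf + |t| * B := by
          rw [abs_mul]; exact add_le_add (hCf u) (mul_le_mul_of_nonneg_left (hwB u) (abs_nonneg t))
  have hexpi : ∀ t : ℝ, Integrable (fun u => exp (f u + t * w u)) μ := fun t =>
    integrable_of_measurable_of_abs_le (hmeas t).exp (C := exp (Cf + |t| * B)) fun u => by
      rw [abs_of_nonneg (exp_pos _).le]
      exact exp_le_exp.2 ((le_abs_self _).trans (hbdd t u))
  haveI hprob : ∀ t, IsProbabilityMeasure (ν t) := fun t => isProbabilityMeasure_tilted (hexpi t)
  have hstep : ∀ t h : ℝ, ν (t + h) = (ν t).tilted (fun u => h * w u) := fun t h => by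
    simp only [hν]
    rw [tilted_tilted (hexpi t)]
    congr 1
    funext u
    simp only [Pi.add_apply]
    ring
  -- integrability facts
  obtain ⟨Cφ, hCφ⟩ := hφb
  have hφi : ∀ t, Integrable φ (ν t) := fun t => integrable_of_measurable_of_abs_le hφ hCφ
  -- one step of size `h > 0`
  have hone : ∀ t ∈ Set.Icc (0 : ℝ) 1, ∀ h : ℝ, 0 < h →
      |∫ s, φ s ∂ν (t + h) - ∫ s, φ s ∂ν t| ≤ L * (exp (h * B) * (h * D)) * exp (h * B) / K := by
    intro t ht h hh
    set ψ : S → ℝ := fun u => exp (h * w u) with hψ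
    have hψm : Measurable ψ := (hw.const_mul h).exp
    have hψB : ∀ u, |ψ u| ≤ exp (h * B) := fun u => by
      rw [hψ, abs_of_nonneg (exp_pos _).le]
      exact exp_le_exp.2 (mul_le_mul_of_nonneg_left ((le_abs_self _).trans (hwB u)) hh.le)
    have hψpos : ∀ u, exp (-(h * B)) ≤ ψ u := fun u => by
      refine exp_le_exp.2 ?_
      have := (neg_abs_le _).trans ((abs_le.1 (hwB u)).1.trans le_rfl)
      nlinarith [neg_abs_le (w u), (abs_le.1 (hwB u)).1]
    have hψL : ∀ a b, |ψ a - ψ b| ≤ exp (h * B) * (h * D) * r a b := fun a b => by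
      have ha : h * w a ≤ h * B := mul_le_mul_of_nonneg_left ((le_abs_self _).trans (hwB a)) hh.le
      have hb : h * w b ≤ h * B := mul_le_mul_of_nonneg_left ((le_abs_self _).trans (hwB b)) hh.le
      calc |ψ a - ψ b| ≤ exp (h * B) * |h * w a - h * w b| := abs_exp_sub_exp_le_of_le ha hb
        _ = exp (h * B) * (h * |w a - w b|) := by rw [← mul_sub, abs_mul, abs_of_pos hh]
        _ ≤ exp (h * B) * (h * (D * r a b)) := by gcongr; exact hwD a b
        _ = exp (h * B) * (h * D) * r a b := by ring
    have hψi : Integrable ψ (ν t) := integrable_of_measurable_of_abs_le hψm hψB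
    -- the variance bounds from the hypothesis
    have hVφ := hP t ht φ L hφ ⟨Cφ, hCφ⟩ hL hφL
    have hVψ := hP t ht ψ (exp (h * B) * (h * D)) hψm ⟨_, hψB⟩ (by positivity) hψL
    have hcov := abs_integral_mul_sub_le_of_variance_le (ν := ν t) hK hL (by positivity) hφ ⟨Cφ, hCφ⟩
      hψm ⟨_, hψB⟩ hVφ hVψ
    -- the step identity
    have hZ : exp (-(h * B)) ≤ ∫ s, ψ s ∂ν t := by
      calc exp (-(h * B)) = ∫ _s, exp (-(h * B)) ∂ν t := by simp
        _ ≤ ∫ s, ψ s ∂ν t := integral_mono (integrable_const _) hψi hψpos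
    have hZpos : 0 < ∫ s, ψ s ∂ν t := (exp_pos _).trans_le hZ
    rw [hstep t h, integral_tilted_sub_integral_eq hψi, abs_div, abs_of_pos hZpos,
      div_le_iff₀ hZpos]
    have hcov' : |∫ s, exp (h * w s) * φ s ∂ν t - (∫ s, exp (h * w s) ∂ν t) * ∫ s, φ s ∂ν t| ≤
        L * (exp (h * B) * (h * D)) / K := by
      have hcomm : ∫ s, exp (h * w s) * φ s ∂ν t = ∫ s, φ s * ψ s ∂ν t := by
        congr 1; funext s; rw [hψ, mul_comm]
      rw [hcomm, mul_comm (∫ s, exp (h * w s) ∂ν t)]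
      exact hcov
    calc |∫ s, exp (h * w s) * φ s ∂ν t - (∫ s, exp (h * w s) ∂ν t) * ∫ s, φ s ∂ν t|
        ≤ L * (exp (h * B) * (h * D)) / K := hcov'
      _ = L * (exp (h * B) * (h * D)) * exp (h * B) / K * exp (-(h * B)) := by
          rw [exp_neg]
          field_simp
      _ ≤ L * (exp (h * B) * (h * D)) * exp (h * B) / K * ∫ s, ψ s ∂ν t :=
          mul_le_mul_of_nonneg_left hZ (by positivity)
  -- telescoping over `n` steps of size `1/n`
  have htel : ∀ n : ℕ, 0 < n →
      |∫ s, φ s ∂ν 1 - ∫ s, φ s ∂ν 0| ≤ L * D * exp (2 * (B / n)) / K := by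
    intro n hn
    have hn' : (0 : ℝ) < n := by exact_mod_cast hn
    set a : ℕ → ℝ := fun k => ∫ s, φ s ∂ν (k / n) with ha
    have h0 : a 0 = ∫ s, φ s ∂ν 0 := by simp [ha]
    have h1 : a n = ∫ s, φ s ∂ν 1 := by simp [ha, div_self hn'.ne']
    rw [← h1, ← h0, ← Finset.sum_range_sub a n]
    refine (Finset.abs_sum_le_sum_abs _ _).trans ?_
    have hk : ∀ k ∈ Finset.range n,
        |a (k + 1) - a k| ≤ L * (exp (1 / n * B) * (1 / n * D)) * exp (1 / n * B) / K := by
      intro k hk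
      have hkn : (k : ℝ) / n ∈ Set.Icc (0 : ℝ) 1 :=
        ⟨by positivity, (div_le_one hn').2 (by exact_mod_cast (Finset.mem_range.1 hk).le)⟩
      have hstep' := hone (k / n) hkn (1 / n) (by positivity)
      have hidx : (k : ℝ) / n + 1 / n = ((k + 1 : ℕ) : ℝ) / n := by push_cast; ring
      rw [hidx] at hstep'
      exact hstep'
    calc ∑ k ∈ Finset.range n, |a (k + 1) - a k|
        ≤ ∑ _k ∈ Finset.range n, L * (exp (1 / n * B) * (1 / n * D)) * exp (1 / n * B) / K :=
          Finset.sum_le_sum hk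
      _ = L * D * exp (2 * (B / n)) / K := by
          rw [Finset.sum_const, Finset.card_range, nsmul_eq_mul]
          have h2 : exp (2 * (B / n)) = exp (1 / n * B) * exp (1 / n * B) := by
            rw [← exp_add]; congr 1; ring
          rw [h2]
          field_simp
  -- let `n → ∞`
  have hlim : Tendsto (fun n : ℕ => L * D * exp (2 * (B / n)) / K) atTop (𝓝 (L * D / K)) := by
    have h1 : Tendsto (fun n : ℕ => B / (n : ℝ)) atTop (𝓝 0) := tendsto_const_div_atTop_nhds_zero_nat B
    have h1' : Tendsto (fun n : ℕ => 2 * (B / (n : ℝ))) atTop (𝓝 0) := by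
      simpa using h1.const_mul 2
    have h2 : Tendsto (fun n : ℕ => exp (2 * (B / n))) atTop (𝓝 1) := by
      have := (continuous_exp.tendsto 0).comp h1'
      rw [exp_zero] at this
      exact this
    have h3 := (h2.const_mul (L * D)).div_const K
    simpa using h3
  have hmain : |∫ s, φ s ∂ν 1 - ∫ s, φ s ∂ν 0| ≤ L * D / K :=
    ge_of_tendsto hlim (Filter.eventually_atTop.2 ⟨1, fun n hn => htel n hn⟩)
  have hν1 : ν 1 = μ.tilted (fun u => f u + w u) := by simp [hν]
  have hν0 : ν 0 = μ.tilted f := by simp [hν]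
  rw [← hν1, ← hν0]
  exact hmain

end TiltPerturbation

/-! ### Matrix toolkit: the Frobenius (Hilbert–Schmidt) norm and the `ℓ²`-operator norm -/

section Frobenius

variable {n : Type*} [Fintype n]

/-- The Frobenius (Hilbert–Schmidt) norm `‖A‖_F = (∑ᵢⱼ |Aᵢⱼ|²)^{1/2} = (Re tr A*A)^{1/2}` of a
complex square matrix — the norm of the inner product `⟨X, Y⟩ = Re tr(X Y*)` used by
Shen–Zhu–Zhu (CMP 400 (2023), arXiv:2204.12737 §2 (2.3), p. 10) to define the bi-invariant metric on `SU(N)`; it is the norm of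
Mathlib's non-instance `Matrix.frobeniusNormedAddCommGroup` (`frobNorm_eq_norm`), written out so
that statements do not depend on a choice of norm instance on matrices. [cite: arXiv220412737, §2 (2.3) (p. 10)] -/
def frobNorm (A : Matrix n n ℂ) : ℝ := Real.sqrt (∑ i, ∑ j, ‖A i j‖ ^ 2)

/-- `‖A‖_F ≥ 0`. [folklore] -/
theorem frobNorm_nonneg (A : Matrix n n ℂ) : 0 ≤ frobNorm A := Real.sqrt_nonneg _

/-- `‖A‖_F² = ∑ᵢⱼ |Aᵢⱼ|²`. [folklore] -/
theorem frobNorm_sq (A : Matrix n n ℂ) : frobNorm A ^ 2 = ∑ i, ∑ j, ‖A i j‖ ^ 2 :=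
  Real.sq_sqrt (by positivity)

section LocalNorm

attribute [local instance] Matrix.frobeniusSeminormedAddCommGroup Matrix.frobeniusNormedAddCommGroup
  Matrix.frobeniusNormedSpace

/-- `frobNorm` is the norm of `Matrix.frobeniusNormedAddCommGroup`. [folklore] -/
theorem frobNorm_eq_norm (A : Matrix n n ℂ) : frobNorm A = ‖A‖ := by
  rw [frobNorm, Matrix.frobenius_norm_def, Real.sqrt_eq_rpow]
  simp_rw [Real.rpow_two]

/-- `‖A - B‖_F = ‖B - A‖_F`. [folklore] -/
theorem frobNorm_sub_comm (A B : Matrix n n ℂ) : frobNorm (A - B) = frobNorm (B - A) := by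
  rw [frobNorm_eq_norm, frobNorm_eq_norm, norm_sub_rev]

/-- Triangle inequality for `‖·‖_F`. [folklore] -/
theorem frobNorm_add_le (A B : Matrix n n ℂ) : frobNorm (A + B) ≤ frobNorm A + frobNorm B := by
  simp only [frobNorm_eq_norm]; exact norm_add_le _ _

/-- Triangle inequality for `‖·‖_F`-distances. [folklore] -/
theorem frobNorm_sub_le (A B C : Matrix n n ℂ) :
    frobNorm (A - C) ≤ frobNorm (A - B) + frobNorm (B - C) := by
  simp only [frobNorm_eq_norm]; exact norm_sub_le_norm_sub_add_norm_sub _ _ _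

/-- `‖∑ᵢ Aᵢ‖_F ≤ ∑ᵢ ‖Aᵢ‖_F`. [folklore] -/
theorem frobNorm_sum_le {ι : Type*} (s : Finset ι) (A : ι → Matrix n n ℂ) :
    frobNorm (∑ i ∈ s, A i) ≤ ∑ i ∈ s, frobNorm (A i) := by
  simp only [frobNorm_eq_norm]; exact norm_sum_le _ _

/-- `‖c A‖_F = |c| ‖A‖_F`. [folklore] -/
theorem frobNorm_smul (c : ℂ) (A : Matrix n n ℂ) : frobNorm (c • A) = ‖c‖ * frobNorm A := by
  simp only [frobNorm_eq_norm]; exact norm_smul c A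

/-- `‖0‖_F = 0`. [folklore] -/
theorem frobNorm_zero : frobNorm (0 : Matrix n n ℂ) = 0 := by
  rw [frobNorm_eq_norm, norm_zero]

/-- `‖A*‖_F = ‖A‖_F`. [folklore] -/
theorem frobNorm_conjTranspose (A : Matrix n n ℂ) : frobNorm Aᴴ = frobNorm A := by
  simp only [frobNorm_eq_norm]; exact Matrix.frobenius_norm_conjTranspose A

/-- `‖A - B‖_F ≤ ‖A‖_F + ‖B‖_F`. [folklore] -/
theorem frobNorm_sub_le_add (A B : Matrix n n ℂ) : frobNorm (A - B) ≤ frobNorm A + frobNorm B := by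
  simp only [frobNorm_eq_norm]; exact norm_sub_le _ _

end LocalNorm

/-- An entry is bounded by the Frobenius norm. [folklore] -/
theorem norm_entry_le_frobNorm (A : Matrix n n ℂ) (i j : n) : ‖A i j‖ ≤ frobNorm A := by
  rw [frobNorm, Real.le_sqrt (norm_nonneg _) (by positivity)]
  calc ‖A i j‖ ^ 2 ≤ ∑ j', ‖A i j'‖ ^ 2 :=
        Finset.single_le_sum (f := fun j' => ‖A i j'‖ ^ 2) (fun _ _ => sq_nonneg _) (Finset.mem_univ j)
    _ ≤ ∑ i', ∑ j', ‖A i' j'‖ ^ 2 :=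
        Finset.single_le_sum (f := fun i' => ∑ j', ‖A i' j'‖ ^ 2) (fun _ _ => by positivity)
          (Finset.mem_univ i)

/-- `‖A‖_F² = Re tr(A* A)`. [folklore] -/
theorem frobNorm_sq_eq_re_trace (A : Matrix n n ℂ) : frobNorm A ^ 2 = (Aᴴ * A).trace.re := by
  rw [frobNorm_sq, Matrix.trace]
  simp only [Matrix.diag_apply, Matrix.mul_apply, Matrix.conjTranspose_apply, Complex.re_sum]
  rw [Finset.sum_comm]
  refine Finset.sum_congr rfl fun j _ => Finset.sum_congr rfl fun i _ => ?_
  rw [Complex.star_def, Complex.conj_mul', ← Complex.ofReal_pow, Complex.ofReal_re]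

variable [DecidableEq n]

/-- **Unitary invariance** `‖U A‖_F = ‖A‖_F`. [folklore] -/
theorem frobNorm_unitary_mul {U : Matrix n n ℂ} (hU : U ∈ Matrix.unitaryGroup n ℂ)
    (A : Matrix n n ℂ) : frobNorm (U * A) = frobNorm A := by
  have hU' : Uᴴ * U = 1 := by
    rw [← Matrix.star_eq_conjTranspose]; exact Matrix.mem_unitaryGroup_iff'.1 hU
  refine (sq_eq_sq₀ (frobNorm_nonneg _) (frobNorm_nonneg _)).1 ?_
  rw [frobNorm_sq_eq_re_trace, frobNorm_sq_eq_re_trace, Matrix.conjTranspose_mul,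
    Matrix.mul_assoc, ← Matrix.mul_assoc Uᴴ, hU', Matrix.one_mul]

/-- **Unitary invariance** `‖A U‖_F = ‖A‖_F`. [folklore] -/
theorem frobNorm_mul_unitary (A : Matrix n n ℂ) {U : Matrix n n ℂ}
    (hU : U ∈ Matrix.unitaryGroup n ℂ) : frobNorm (A * U) = frobNorm A := by
  have hU' : U * Uᴴ = 1 := by
    rw [← Matrix.star_eq_conjTranspose]; exact Matrix.mem_unitaryGroup_iff.1 hU
  refine (sq_eq_sq₀ (frobNorm_nonneg _) (frobNorm_nonneg _)).1 ?_
  rw [frobNorm_sq_eq_re_trace, frobNorm_sq_eq_re_trace, Matrix.conjTranspose_mul,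
    Matrix.mul_assoc, Matrix.trace_mul_comm, Matrix.mul_assoc, Matrix.mul_assoc, hU',
    Matrix.mul_one]

omit [DecidableEq n] in
/-- **Cauchy–Schwarz for the Hilbert–Schmidt pairing**: `|Re tr(A B)| ≤ ‖A‖_F ‖B‖_F`
(Shen–Zhu–Zhu CMP 400 (2023), proof of Lemma 4.1). [folklore] -/
theorem abs_re_trace_mul_le (A B : Matrix n n ℂ) :
    |(A * B).trace.re| ≤ frobNorm A * frobNorm B := by
  refine (Complex.abs_re_le_norm _).trans ?_
  rw [Matrix.trace]
  simp only [Matrix.diag_apply, Matrix.mul_apply]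
  calc ‖∑ i, ∑ j, A i j * B j i‖ ≤ ∑ i, ‖∑ j, A i j * B j i‖ := norm_sum_le _ _
    _ ≤ ∑ i, ∑ j, ‖A i j‖ * ‖B j i‖ :=
        Finset.sum_le_sum fun i _ => (norm_sum_le _ _).trans (Finset.sum_le_sum fun j _ => by
          rw [norm_mul])
    _ = ∑ p ∈ (Finset.univ : Finset (n × n)), ‖A p.1 p.2‖ * ‖B p.2 p.1‖ := by
        rw [← Finset.univ_product_univ, Finset.sum_product]
    _ ≤ Real.sqrt (∑ p ∈ (Finset.univ : Finset (n × n)), ‖A p.1 p.2‖ ^ 2) *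
          Real.sqrt (∑ p ∈ (Finset.univ : Finset (n × n)), ‖B p.2 p.1‖ ^ 2) :=
        Real.sum_mul_le_sqrt_mul_sqrt _ _ _
    _ = frobNorm A * frobNorm B := by
        congr 1
        · rw [frobNorm, ← Finset.univ_product_univ, Finset.sum_product]
        · rw [frobNorm, ← Finset.univ_product_univ, Finset.sum_product, Finset.sum_comm]

/-- `‖U‖_F² = |n|` for unitary `U`. [folklore] -/
theorem frobNorm_sq_of_mem_unitaryGroup {U : Matrix n n ℂ} (hU : U ∈ Matrix.unitaryGroup n ℂ) :
    frobNorm U ^ 2 = Fintype.card n := by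
  have hU' : Uᴴ * U = 1 := by
    rw [← Matrix.star_eq_conjTranspose]; exact Matrix.mem_unitaryGroup_iff'.1 hU
  rw [frobNorm_sq_eq_re_trace, hU', Matrix.trace_one]
  simp

/-- `‖U - V‖_F ≤ 2 √n` for unitary `U, V`. [folklore] -/
theorem frobNorm_sub_le_of_mem_unitaryGroup {U V : Matrix n n ℂ} (hU : U ∈ Matrix.unitaryGroup n ℂ)
    (hV : V ∈ Matrix.unitaryGroup n ℂ) : frobNorm (U - V) ≤ 2 * Real.sqrt (Fintype.card n) := by
  have hU1 : frobNorm U = Real.sqrt (Fintype.card n) := by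
    rw [← frobNorm_sq_of_mem_unitaryGroup hU, Real.sqrt_sq (frobNorm_nonneg _)]
  have hV1 : frobNorm V = Real.sqrt (Fintype.card n) := by
    rw [← frobNorm_sq_of_mem_unitaryGroup hV, Real.sqrt_sq (frobNorm_nonneg _)]
  calc frobNorm (U - V) ≤ frobNorm U + frobNorm V := frobNorm_sub_le_add U V
    _ = 2 * Real.sqrt (Fintype.card n) := by rw [hU1, hV1]; ring

/-- The `ℓ²`-**operator norm** `‖B‖_op = sup_{|v| = 1} |B v|` of a complex square matrix: the norm of
Mathlib's non-instance `Matrix.instL2OpNormedAddCommGroup` (scope `Matrix.Norms.L2Operator`),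
written through `Matrix.toEuclideanCLM` so that statements do not depend on a choice of norm
instance on matrices (`Matrix.cstar_norm_def`). It controls the Hessian of `g ↦ N Re tr(g B)` on
`SU(N)`: `|Re tr(g X² B)| ≤ ‖X‖_F² ‖B‖_op` (one-link case of Shen–Zhu–Zhu Lemma 4.1).
[folklore] -/
def matrixOpNorm (B : Matrix n n ℂ) : ℝ := ‖Matrix.toEuclideanCLM (n := n) (𝕜 := ℂ) B‖

open scoped Matrix.Norms.L2Operator in
/-- `matrixOpNorm` is the `ℓ²`-operator norm. [folklore] -/
theorem matrixOpNorm_eq_norm (B : Matrix n n ℂ) : matrixOpNorm B = ‖B‖ := rfl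

open scoped Matrix.Norms.L2Operator in
/-- `‖B‖_op ≥ 0`. [folklore] -/
theorem matrixOpNorm_nonneg (B : Matrix n n ℂ) : 0 ≤ matrixOpNorm B := norm_nonneg _

open scoped Matrix.Norms.L2Operator in
/-- Triangle inequality for `‖·‖_op`. [folklore] -/
theorem matrixOpNorm_add_le (A B : Matrix n n ℂ) : matrixOpNorm (A + B) ≤ matrixOpNorm A + matrixOpNorm B :=
  norm_add_le A B

open scoped Matrix.Norms.L2Operator in
/-- `‖∑ᵢ Aᵢ‖_op ≤ ∑ᵢ ‖Aᵢ‖_op`. [folklore] -/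
theorem matrixOpNorm_sum_le {ι : Type*} (s : Finset ι) (A : ι → Matrix n n ℂ) :
    matrixOpNorm (∑ i ∈ s, A i) ≤ ∑ i ∈ s, matrixOpNorm (A i) :=
  norm_sum_le s A

open scoped Matrix.Norms.L2Operator in
/-- `‖c A‖_op = |c| ‖A‖_op`. [folklore] -/
theorem matrixOpNorm_smul (c : ℂ) (A : Matrix n n ℂ) : matrixOpNorm (c • A) = ‖c‖ * matrixOpNorm A :=
  norm_smul c A

open scoped Matrix.Norms.L2Operator in
/-- A unitary matrix has operator norm `1` (`CStarRing.norm_of_mem_unitary`). [folklore] -/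
theorem matrixOpNorm_of_mem_unitaryGroup [Nonempty n] {U : Matrix n n ℂ}
    (hU : U ∈ Matrix.unitaryGroup n ℂ) : matrixOpNorm U = 1 := by
  rw [matrixOpNorm_eq_norm]
  exact CStarRing.norm_of_mem_unitary hU

end Frobenius

/-! ### Staples: the one-link Wilson action is `g ↦ -N β Re tr(g S_ω) + const` -/

section Staples

variable {d : ℕ} {G : Type*} [Group G]

/-- The first link `(x, i)` of the plaquette `p = (x, i < j)` (order of `plaquetteEdges`,
`plaquetteHolonomyZd`). [folklore] -/
def plaqLink1 (p : ZdPlaquette d) : ZdEdge d := (p.1, p.2.1.1)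

/-- The second link `(x + eᵢ, j)` of the plaquette `p = (x, i < j)`. [folklore] -/
def plaqLink2 (p : ZdPlaquette d) : ZdEdge d := (p.1 + Pi.single p.2.1.1 1, p.2.1.2)

/-- The third link `(x + eⱼ, i)` of the plaquette `p = (x, i < j)` (traversed backwards). [folklore] -/
def plaqLink3 (p : ZdPlaquette d) : ZdEdge d := (p.1 + Pi.single p.2.1.2 1, p.2.1.1)

/-- The fourth link `(x, j)` of the plaquette `p = (x, i < j)` (traversed backwards). [folklore] -/
def plaqLink4 (p : ZdPlaquette d) : ZdEdge d := (p.1, p.2.1.2)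

/-- `plaquetteEdges` in terms of the named links. [folklore] -/
theorem plaquetteEdges_eq (p : ZdPlaquette d) :
    plaquetteEdges p = {plaqLink1 p, plaqLink2 p, plaqLink3 p, plaqLink4 p} := rfl

/-- `plaquetteHolonomyZd` in terms of the named links: `U_p = U₁ U₂ U₃⁻¹ U₄⁻¹`. [folklore] -/
theorem plaquetteHolonomyZd_eq (U : LGConfig d G) (p : ZdPlaquette d) :
    plaquetteHolonomyZd U p.1 p.2.1.1 p.2.1.2 =
      U (plaqLink1 p) * U (plaqLink2 p) * (U (plaqLink3 p))⁻¹ * (U (plaqLink4 p))⁻¹ := rfl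

/-- A unit lattice vector is non-zero. [folklore] -/
theorem pi_single_one_ne_zero (k : Fin d) : (Pi.single k (1 : ℤ) : Fin d → ℤ) ≠ 0 := fun h => by
  have := congrFun h k
  simp at this

/-- The links `(x, i)` and `(x + eᵢ, j)` of a plaquette differ (directions `i < j`). [folklore] -/
theorem plaqLink1_ne_plaqLink2 (p : ZdPlaquette d) : plaqLink1 p ≠ plaqLink2 p := fun h =>
  (p.2.2).ne (congrArg Prod.snd h)

/-- The links `(x, i)` and `(x + eⱼ, i)` of a plaquette differ (base points). [folklore] -/
theorem plaqLink1_ne_plaqLink3 (p : ZdPlaquette d) : plaqLink1 p ≠ plaqLink3 p := fun h =>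
  pi_single_one_ne_zero p.2.1.2 (left_eq_add.1 (congrArg Prod.fst h))

/-- The links `(x, i)` and `(x, j)` of a plaquette differ (directions `i < j`). [folklore] -/
theorem plaqLink1_ne_plaqLink4 (p : ZdPlaquette d) : plaqLink1 p ≠ plaqLink4 p := fun h =>
  (p.2.2).ne (congrArg Prod.snd h)

/-- The links `(x + eᵢ, j)` and `(x + eⱼ, i)` of a plaquette differ (directions). [folklore] -/
theorem plaqLink2_ne_plaqLink3 (p : ZdPlaquette d) : plaqLink2 p ≠ plaqLink3 p := fun h =>
  (p.2.2).ne (congrArg Prod.snd h).symm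

/-- The links `(x + eᵢ, j)` and `(x, j)` of a plaquette differ (base points). [folklore] -/
theorem plaqLink2_ne_plaqLink4 (p : ZdPlaquette d) : plaqLink2 p ≠ plaqLink4 p := fun h =>
  pi_single_one_ne_zero p.2.1.1 (add_eq_left.1 (congrArg Prod.fst h))

/-- The links `(x + eⱼ, i)` and `(x, j)` of a plaquette differ (directions). [folklore] -/
theorem plaqLink3_ne_plaqLink4 (p : ZdPlaquette d) : plaqLink3 p ≠ plaqLink4 p := fun h =>
  (p.2.2).ne (congrArg Prod.snd h)

variable [DecidableEq (ZdEdge d)]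

/-- The **staple** of the plaquette `p` at its link `x` in the configuration `ω`: the ordered
product of the other three link variables (inverted as the orientation demands) for which
`Re tr ρ(U_p(ω^{x ← g})) = Re tr (ρ(g) ρ(staple))` (`re_trace_holonomy_update`)
(Shen–Zhu–Zhu CMP 400 (2023) §4.1, proof of Lemma 4.1: "`𝒮` is a linear (affine) function in each
variable `Q_e`"; Chatterjee arXiv:1803.01950 §2). Junk value if `x ∉ p`. [folklore] -/
def staple (p : ZdPlaquette d) (x : ZdEdge d) (ω : LGConfig d G) : G :=
  if x = plaqLink1 p then ω (plaqLink2 p) * (ω (plaqLink3 p))⁻¹ * (ω (plaqLink4 p))⁻¹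
  else if x = plaqLink2 p then (ω (plaqLink3 p))⁻¹ * (ω (plaqLink4 p))⁻¹ * ω (plaqLink1 p)
  else if x = plaqLink3 p then (ω (plaqLink2 p))⁻¹ * (ω (plaqLink1 p))⁻¹ * ω (plaqLink4 p)
  else ω (plaqLink3 p) * (ω (plaqLink2 p))⁻¹ * (ω (plaqLink1 p))⁻¹

/-- The three links read by `staple p x`, in order. [folklore] -/
def stapleLinks (p : ZdPlaquette d) (x : ZdEdge d) : Fin 3 → ZdEdge d :=
  if x = plaqLink1 p then ![plaqLink2 p, plaqLink3 p, plaqLink4 p]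
  else if x = plaqLink2 p then ![plaqLink3 p, plaqLink4 p, plaqLink1 p]
  else if x = plaqLink3 p then ![plaqLink2 p, plaqLink1 p, plaqLink4 p]
  else ![plaqLink3 p, plaqLink2 p, plaqLink1 p]

/-- A sign pattern `a b⁻¹ c⁻¹` / `a⁻¹ b⁻¹ c` of the staple. [folklore] -/
def stapleWord (s : Bool) (a b c : G) : G := if s then a * b⁻¹ * c⁻¹ else a⁻¹ * b⁻¹ * c

/-- The staple is a `stapleWord` in the three `stapleLinks`. [folklore] -/
theorem staple_eq_stapleWord (p : ZdPlaquette d) (x : ZdEdge d) (ω : LGConfig d G) :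
    staple p x ω = stapleWord (decide (x = plaqLink1 p) || !decide (x = plaqLink2 p) &&
      !decide (x = plaqLink3 p)) (ω (stapleLinks p x 0)) (ω (stapleLinks p x 1))
      (ω (stapleLinks p x 2)) := by
  unfold staple stapleLinks stapleWord
  by_cases h1 : x = plaqLink1 p
  · simp [h1]
  by_cases h2 : x = plaqLink2 p
  · subst h2
    simp [(plaqLink1_ne_plaqLink2 p).symm]
  by_cases h3 : x = plaqLink3 p
  · subst h3
    simp [(plaqLink1_ne_plaqLink3 p).symm, (plaqLink2_ne_plaqLink3 p).symm]
  · simp [h1, h2, h3]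

/-- The staple at `x` does not read the link `x`: configurations agreeing on the three
`stapleLinks` have the same staple. [folklore] -/
theorem staple_congr {p : ZdPlaquette d} {x : ZdEdge d} {ω η : LGConfig d G}
    (h : ∀ k, ω (stapleLinks p x k) = η (stapleLinks p x k)) : staple p x ω = staple p x η := by
  rw [staple_eq_stapleWord, staple_eq_stapleWord, h 0, h 1, h 2]

section Unitary

variable {N : ℕ} (ρ : G →* Matrix (Fin N) (Fin N) ℂ)

/-- A unitary representation sends inverses to adjoints. [folklore] -/
theorem map_inv_eq_conjTranspose (hρu : ∀ g, ρ g ∈ Matrix.unitaryGroup (Fin N) ℂ) (h : G) :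
    ρ h⁻¹ = (ρ h)ᴴ := by
  have h1 : ρ h * (ρ h)ᴴ = 1 := by
    rw [← Matrix.star_eq_conjTranspose]; exact Matrix.mem_unitaryGroup_iff.1 (hρu h)
  calc ρ h⁻¹ = ρ h⁻¹ * (ρ h * (ρ h)ᴴ) := by rw [h1, mul_one]
    _ = (ρ h)ᴴ := by rw [← mul_assoc, ← map_mul, inv_mul_cancel, map_one, one_mul]

/-- `Re tr ρ(h⁻¹) = Re tr ρ(h)` for unitary `ρ`. [folklore] -/
theorem re_trace_map_inv (hρu : ∀ g, ρ g ∈ Matrix.unitaryGroup (Fin N) ℂ) (h : G) :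
    (ρ h⁻¹).trace.re = (ρ h).trace.re := by
  rw [map_inv_eq_conjTranspose ρ hρu, Matrix.trace_conjTranspose, Complex.star_def, Complex.conj_re]

/-- `Re tr ρ(a b) = Re tr ρ(b a)`. [folklore] -/
theorem re_trace_map_mul_comm (a b : G) : (ρ (a * b)).trace.re = (ρ (b * a)).trace.re := by
  rw [map_mul, map_mul, Matrix.trace_mul_comm]

/-- **The plaquette action is affine in each link**: for `x ∈ p`,
`Re tr ρ(U_p(ω^{x ← g})) = Re tr(ρ(g) ρ(staple_p^x(ω)))` (cyclicity of the trace and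
`Re tr ρ(h⁻¹) = Re tr ρ(h)`; the four positions of `x` on `p`) (Shen–Zhu–Zhu CMP 400 (2023) §4.1).
[folklore] -/
theorem re_trace_holonomy_update (hρu : ∀ g, ρ g ∈ Matrix.unitaryGroup (Fin N) ℂ)
    {p : ZdPlaquette d} {x : ZdEdge d} (hx : x ∈ plaquetteEdges p) (ω : LGConfig d G) (g : G) :
    (ρ (plaquetteHolonomyZd (Function.update ω x g) p.1 p.2.1.1 p.2.1.2)).trace.re =
      (ρ g * ρ (staple p x ω)).trace.re := by
  rw [plaquetteHolonomyZd_eq, ← map_mul]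
  have h12 := plaqLink1_ne_plaqLink2 p
  have h13 := plaqLink1_ne_plaqLink3 p
  have h14 := plaqLink1_ne_plaqLink4 p
  have h23 := plaqLink2_ne_plaqLink3 p
  have h24 := plaqLink2_ne_plaqLink4 p
  have h34 := plaqLink3_ne_plaqLink4 p
  rw [plaquetteEdges_eq] at hx
  simp only [Finset.mem_insert, Finset.mem_singleton] at hx
  unfold staple
  rcases hx with rfl | rfl | rfl | rfl
  · simp only [if_true, Function.update_self, Function.update_of_ne h12.symm,
      Function.update_of_ne h13.symm, Function.update_of_ne h14.symm, mul_assoc]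
  · simp only [if_neg h12.symm, if_true, Function.update_self, Function.update_of_ne h12,
      Function.update_of_ne h23.symm, Function.update_of_ne h24.symm]
    rw [show ω (plaqLink1 p) * g * (ω (plaqLink3 p))⁻¹ * (ω (plaqLink4 p))⁻¹ =
      ω (plaqLink1 p) * (g * ((ω (plaqLink3 p))⁻¹ * (ω (plaqLink4 p))⁻¹)) by group,
      re_trace_map_mul_comm ρ]
    congr 3
    group
  · simp only [if_neg h13.symm, if_neg h23.symm, if_true, Function.update_self,
      Function.update_of_ne h13, Function.update_of_ne h23, Function.update_of_ne h34.symm]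
    rw [← re_trace_map_inv ρ hρu]
    rw [show (ω (plaqLink1 p) * ω (plaqLink2 p) * g⁻¹ * (ω (plaqLink4 p))⁻¹)⁻¹ =
      ω (plaqLink4 p) * (g * ((ω (plaqLink2 p))⁻¹ * (ω (plaqLink1 p))⁻¹)) by group,
      re_trace_map_mul_comm ρ]
    congr 3
    group
  · simp only [if_neg h14.symm, if_neg h24.symm, if_neg h34.symm, Function.update_self,
      Function.update_of_ne h14, Function.update_of_ne h24, Function.update_of_ne h34]
    rw [← re_trace_map_inv ρ hρu]
    congr 3
    group

/-- **The one-link Wilson action through staples**: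
`S_{x}(ω^{x ← g}) = ∑_{p ∋ x} (N - Re tr(ρ(g) ρ(staple_p^x(ω))))`. [folklore] -/
theorem wilsonBoundaryAction_singleton_update (hρu : ∀ g, ρ g ∈ Matrix.unitaryGroup (Fin N) ℂ)
    (x : ZdEdge d) (ω : LGConfig d G) (g : G) :
    wilsonBoundaryAction ρ {x} (Function.update ω x g) =
      ∑ p ∈ plaquettesTouching {x}, ((N : ℝ) - (ρ g * ρ (staple p x ω)).trace.re) := by
  unfold wilsonBoundaryAction plaquetteObs
  refine Finset.sum_congr rfl fun p hp => ?_
  rw [re_trace_holonomy_update ρ hρu (mem_plaquettesTouching_singleton.1 hp)]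

end Unitary

end Staples

/-! ### `SU(N)`: the one-link law in 't Hooft form and its Lipschitz dependence on a neighbour -/

section SUN

variable {d N : ℕ}

/-- Inversion in `SU(N)` is the conjugate transpose. [folklore] -/
theorem su_coe_inv (a : Matrix.specialUnitaryGroup (Fin N) ℂ) :
    ((a⁻¹ : Matrix.specialUnitaryGroup (Fin N) ℂ) : Matrix (Fin N) (Fin N) ℂ) =
      (a : Matrix (Fin N) (Fin N) ℂ)ᴴ := rfl

/-- Elements of `SU(N)` are unitary matrices. [folklore] -/
theorem su_mem_unitaryGroup (a : Matrix.specialUnitaryGroup (Fin N) ℂ) :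
    (a : Matrix (Fin N) (Fin N) ℂ) ∈ Matrix.unitaryGroup (Fin N) ℂ :=
  Matrix.specialUnitaryGroup_le_unitaryGroup a.2

/-- Adjoints of elements of `SU(N)` are unitary matrices. [folklore] -/
theorem su_conjTranspose_mem_unitaryGroup (a : Matrix.specialUnitaryGroup (Fin N) ℂ) :
    (a : Matrix (Fin N) (Fin N) ℂ)ᴴ ∈ Matrix.unitaryGroup (Fin N) ℂ :=
  Unitary.star_mem (su_mem_unitaryGroup a)

/-- `‖g‖_F = √N` on `SU(N)`. [folklore] -/
theorem frobNorm_su (a : Matrix.specialUnitaryGroup (Fin N) ℂ) :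
    frobNorm (a : Matrix (Fin N) (Fin N) ℂ) = Real.sqrt N := by
  rw [← Real.sqrt_sq (frobNorm_nonneg _), frobNorm_sq_of_mem_unitaryGroup (su_mem_unitaryGroup a),
    Fintype.card_fin]

/-- The **Frobenius (chordal, Hilbert–Schmidt) distance** `‖a - b‖_F` on `SU(N) ⊆ M_N(ℂ)`: the
weight `r` of the Dobrushin scheme. It is dominated by the bi-invariant Riemannian distance of the
Hilbert–Schmidt metric (chords are shorter than arcs), so Lipschitz constants with respect to it
bound Riemannian gradients. [folklore] -/
def suFrobDist (a b : Matrix.specialUnitaryGroup (Fin N) ℂ) : ℝ :=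
  frobNorm ((a : Matrix (Fin N) (Fin N) ℂ) - (b : Matrix (Fin N) (Fin N) ℂ))

/-- `suFrobDist ≥ 0`. [folklore] -/
theorem suFrobDist_nonneg (a b : Matrix.specialUnitaryGroup (Fin N) ℂ) : 0 ≤ suFrobDist a b := frobNorm_nonneg _

/-- `suFrobDist` is symmetric. [folklore] -/
theorem suFrobDist_comm (a b : Matrix.specialUnitaryGroup (Fin N) ℂ) : suFrobDist a b = suFrobDist b a := frobNorm_sub_comm _ _

/-- `suFrobDist a a = 0`. [folklore] -/
theorem suFrobDist_self (a : Matrix.specialUnitaryGroup (Fin N) ℂ) : suFrobDist a a = 0 := by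
  rw [suFrobDist, sub_self, frobNorm_zero]

/-- The Frobenius (chordal) distance on `SU(N)` is bounded by `2 √N`. [folklore] -/
theorem suFrobDist_le (a b : Matrix.specialUnitaryGroup (Fin N) ℂ) : suFrobDist a b ≤ 2 * Real.sqrt N := by
  have := frobNorm_sub_le_of_mem_unitaryGroup (su_mem_unitaryGroup a) (su_mem_unitaryGroup b)
  rwa [Fintype.card_fin] at this

/-- The entry (sup) metric on `SU(N)` is dominated by the Frobenius distance. [folklore] -/
theorem dist_suEntries_le_suFrobDist (a b : Matrix.specialUnitaryGroup (Fin N) ℂ) :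
    dist (suEntries a) (suEntries b) ≤ suFrobDist a b := by
  refine (dist_pi_le_iff (frobNorm_nonneg _)).2 fun i => (dist_pi_le_iff (frobNorm_nonneg _)).2
    fun j => ?_
  rw [dist_eq_norm]
  exact norm_entry_le_frobNorm ((a : Matrix (Fin N) (Fin N) ℂ) - (b : Matrix (Fin N) (Fin N) ℂ)) i j

/-- **Telescoping**: `‖A₁A₂A₃ - B₁B₂B₃‖_F ≤ ∑ₖ ‖Aₖ - Bₖ‖_F` for unitary factors. [folklore] -/
theorem frobNorm_triple_sub_le {A₁ A₂ A₃ B₁ B₂ B₃ : Matrix (Fin N) (Fin N) ℂ}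
    (hA₂ : A₂ ∈ Matrix.unitaryGroup (Fin N) ℂ) (hA₃ : A₃ ∈ Matrix.unitaryGroup (Fin N) ℂ)
    (hB₁ : B₁ ∈ Matrix.unitaryGroup (Fin N) ℂ) (hB₂ : B₂ ∈ Matrix.unitaryGroup (Fin N) ℂ) :
    frobNorm (A₁ * A₂ * A₃ - B₁ * B₂ * B₃) ≤
      frobNorm (A₁ - B₁) + frobNorm (A₂ - B₂) + frobNorm (A₃ - B₃) := by
  have hsplit : A₁ * A₂ * A₃ - B₁ * B₂ * B₃ =
      (A₁ - B₁) * A₂ * A₃ + B₁ * (A₂ - B₂) * A₃ + B₁ * B₂ * (A₃ - B₃) := by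
    simp only [sub_mul, mul_sub]
    abel
  rw [hsplit]
  calc frobNorm ((A₁ - B₁) * A₂ * A₃ + B₁ * (A₂ - B₂) * A₃ + B₁ * B₂ * (A₃ - B₃))
      ≤ frobNorm ((A₁ - B₁) * A₂ * A₃ + B₁ * (A₂ - B₂) * A₃) + frobNorm (B₁ * B₂ * (A₃ - B₃)) :=
        frobNorm_add_le _ _
    _ ≤ frobNorm ((A₁ - B₁) * A₂ * A₃) + frobNorm (B₁ * (A₂ - B₂) * A₃) +
          frobNorm (B₁ * B₂ * (A₃ - B₃)) := add_le_add (frobNorm_add_le _ _) le_rfl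
    _ = frobNorm (A₁ - B₁) + frobNorm (A₂ - B₂) + frobNorm (A₃ - B₃) := by
        rw [frobNorm_mul_unitary _ hA₃, frobNorm_mul_unitary _ hA₂, frobNorm_mul_unitary _ hA₃,
          frobNorm_unitary_mul hB₁, frobNorm_unitary_mul (Submonoid.mul_mem _ hB₁ hB₂)]

/-- The staple words are `1`-Lipschitz in each letter for the Frobenius distance. [folklore] -/
theorem suFrobDist_stapleWord_le (s : Bool) (a b c a' b' c' : Matrix.specialUnitaryGroup (Fin N) ℂ) :
    suFrobDist (stapleWord s a b c) (stapleWord s a' b' c') ≤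
      suFrobDist a a' + suFrobDist b b' + suFrobDist c c' := by
  unfold suFrobDist
  cases s
  · simp only [stapleWord, Bool.false_eq_true, if_false, Submonoid.coe_mul, su_coe_inv]
    refine (frobNorm_triple_sub_le ?_ (su_mem_unitaryGroup c) ?_ ?_).trans ?_
    · exact su_conjTranspose_mem_unitaryGroup b
    · exact su_conjTranspose_mem_unitaryGroup a'
    · exact su_conjTranspose_mem_unitaryGroup b'
    · rw [← Matrix.conjTranspose_sub, ← Matrix.conjTranspose_sub, frobNorm_conjTranspose,
        frobNorm_conjTranspose]
  · simp only [stapleWord, if_true, Submonoid.coe_mul, su_coe_inv]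
    refine (frobNorm_triple_sub_le ?_ ?_ (su_mem_unitaryGroup a') ?_).trans ?_
    · exact su_conjTranspose_mem_unitaryGroup b
    · exact su_conjTranspose_mem_unitaryGroup c
    · exact su_conjTranspose_mem_unitaryGroup b'
    · rw [← Matrix.conjTranspose_sub, ← Matrix.conjTranspose_sub, frobNorm_conjTranspose,
        frobNorm_conjTranspose]

variable [DecidableEq (ZdEdge d)]

/-- **Lipschitz dependence of the staple on the links it reads**:
`‖T_p^x(ω) - T_p^x(η)‖_F ≤ ∑ₖ ‖ω(eₖ) - η(eₖ)‖_F` over the three staple links. [folklore] -/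
theorem suFrobDist_staple_le (p : ZdPlaquette d) (x : ZdEdge d)
    (ω η : LGConfig d (Matrix.specialUnitaryGroup (Fin N) ℂ)) :
    suFrobDist (staple p x ω) (staple p x η) ≤
      ∑ k : Fin 3, suFrobDist (ω (stapleLinks p x k)) (η (stapleLinks p x k)) := by
  rw [staple_eq_stapleWord, staple_eq_stapleWord, Fin.sum_univ_three]
  exact suFrobDist_stapleWord_le _ _ _ _ _ _ _

/-- The **influence count** `n(x, y)`: the number of (plaquette, position) pairs through which the
link `y` enters the one-link law at `x` (for `y ≠ x` this is the number of plaquettes containing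
both, i.e. `0` or `1`; only `∑_y n(x, y) ≤ 6(d-1)` is used). [folklore] -/
def linkInfluence (x y : ZdEdge d) : ℕ :=
  ∑ p ∈ plaquettesTouching {x}, ∑ k : Fin 3, if stapleLinks p x k = y then 1 else 0

omit [DecidableEq (ZdEdge d)] in
/-- **Row sums of the influence count**: `∑_{y ∈ linkPlaqNbr x} n(x, y) ≤ 3 · #{p ∋ x} ≤ 6(d-1)`.
[folklore] -/
theorem sum_linkInfluence_le [DecidableEq (ZdEdge d)] (x : ZdEdge d) :
    ∑ y ∈ linkPlaqNbr x, linkInfluence x y ≤ 6 * (d - 1) := by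
  unfold linkInfluence
  rw [Finset.sum_comm]
  calc ∑ p ∈ plaquettesTouching {x}, ∑ y ∈ linkPlaqNbr x, ∑ k : Fin 3,
        (if stapleLinks p x k = y then 1 else 0)
      ≤ ∑ _p ∈ plaquettesTouching {x}, 3 := by
        refine Finset.sum_le_sum fun p _ => ?_
        rw [Finset.sum_comm]
        calc ∑ k : Fin 3, ∑ y ∈ linkPlaqNbr x, (if stapleLinks p x k = y then 1 else 0)
            ≤ ∑ _k : Fin 3, 1 := Finset.sum_le_sum fun k _ => by
              rw [Finset.sum_ite_eq]
              split_ifs <;> simp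
          _ = 3 := by simp
    _ = 3 * (plaquettesTouching {x}).card := by rw [Finset.sum_const, smul_eq_mul, mul_comm]
    _ ≤ 3 * (2 * (d - 1)) := Nat.mul_le_mul_left 3 (card_plaquettesTouching_singleton_le x)
    _ = 6 * (d - 1) := by ring

/-- The **staple sum** `S_ω = ∑_{p ∋ x} T_p^x(ω) ∈ M_N(ℂ)` at the link `x`
(Shen–Zhu–Zhu's `h`, the sum of the `2(d-1)` staples). [folklore] -/
def stapleSum (x : ZdEdge d) (ω : LGConfig d (Matrix.specialUnitaryGroup (Fin N) ℂ)) :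
    Matrix (Fin N) (Fin N) ℂ :=
  ∑ p ∈ plaquettesTouching {x},
    ((staple p x ω : Matrix.specialUnitaryGroup (Fin N) ℂ) : Matrix (Fin N) (Fin N) ℂ)

/-- `‖S_ω‖_op ≤ #{p ∋ x}` (each staple is unitary). [folklore] -/
theorem matrixOpNorm_stapleSum_le [Nonempty (Fin N)] (x : ZdEdge d)
    (ω : LGConfig d (Matrix.specialUnitaryGroup (Fin N) ℂ)) :
    matrixOpNorm (stapleSum x ω) ≤ (plaquettesTouching {x}).card := by
  refine (matrixOpNorm_sum_le _ _).trans ?_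
  rw [Finset.sum_congr rfl fun p _ => matrixOpNorm_of_mem_unitaryGroup (su_mem_unitaryGroup _),
    Finset.sum_const, nsmul_eq_mul, mul_one]

/-- **Lipschitz dependence of the staple sum on one neighbour link**: if `ω = η` off `y`, then
`‖S_ω - S_η‖_F ≤ n(x, y) ‖ω_y - η_y‖_F`. [folklore] -/
theorem frobNorm_stapleSum_sub_le (x y : ZdEdge d)
    {ω η : LGConfig d (Matrix.specialUnitaryGroup (Fin N) ℂ)} (hωη : ∀ z, z ≠ y → ω z = η z) :
    frobNorm (stapleSum x ω - stapleSum x η) ≤ linkInfluence x y * suFrobDist (ω y) (η y) := by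
  rw [stapleSum, stapleSum, ← Finset.sum_sub_distrib]
  refine (frobNorm_sum_le _ _).trans ?_
  rw [linkInfluence, Nat.cast_sum, Finset.sum_mul]
  refine Finset.sum_le_sum fun p _ => ?_
  refine (suFrobDist_staple_le p x ω η).trans ?_
  rw [Nat.cast_sum, Finset.sum_mul]
  refine Finset.sum_le_sum fun k _ => ?_
  by_cases hk : stapleLinks p x k = y
  · rw [hk, if_pos rfl]
    simp
  · rw [hωη _ hk, suFrobDist_self, if_neg hk]
    simp

/-- The **link field** `B_ω = β S_ω`: the one-link conditional law at 't Hooft coupling `β` is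
`∝ exp(N Re tr(g B_ω)) dg` (`siteLaw_ymSpecification_thooft`). [folklore] -/
def stapleField (β : ℝ) (x : ZdEdge d) (ω : LGConfig d (Matrix.specialUnitaryGroup (Fin N) ℂ)) :
    Matrix (Fin N) (Fin N) ℂ :=
  (β : ℂ) • stapleSum x ω

/-- `‖B_ω‖_op ≤ 2(d-1)|β|`. [folklore] -/
theorem matrixOpNorm_stapleField_le (hd : 1 ≤ d) (hN : 1 ≤ N) (β : ℝ) (x : ZdEdge d)
    (ω : LGConfig d (Matrix.specialUnitaryGroup (Fin N) ℂ)) :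
    matrixOpNorm (stapleField β x ω) ≤ |β| * (2 * ((d : ℝ) - 1)) := by
  haveI : Nonempty (Fin N) := ⟨⟨0, hN⟩⟩
  rw [stapleField, matrixOpNorm_smul, Complex.norm_real, Real.norm_eq_abs]
  refine mul_le_mul_of_nonneg_left ((matrixOpNorm_stapleSum_le x ω).trans ?_) (abs_nonneg β)
  calc ((plaquettesTouching {x}).card : ℝ) ≤ ((2 * (d - 1) : ℕ) : ℝ) := by
        exact_mod_cast card_plaquettesTouching_singleton_le x
    _ = 2 * ((d : ℝ) - 1) := by push_cast [Nat.cast_sub hd]; ring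

/-- `‖B_ω - B_η‖_F ≤ |β| n(x, y) ‖ω_y - η_y‖_F` when `ω = η` off `y`. [folklore] -/
theorem frobNorm_stapleField_sub_le (β : ℝ) (x y : ZdEdge d)
    {ω η : LGConfig d (Matrix.specialUnitaryGroup (Fin N) ℂ)} (hωη : ∀ z, z ≠ y → ω z = η z) :
    frobNorm (stapleField β x ω - stapleField β x η) ≤
      |β| * linkInfluence x y * suFrobDist (ω y) (η y) := by
  rw [stapleField, stapleField, ← smul_sub, frobNorm_smul, Complex.norm_real, Real.norm_eq_abs,
    mul_assoc]
  exact mul_le_mul_of_nonneg_left (frobNorm_stapleSum_sub_le x y hωη) (abs_nonneg β)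

/-- **The one-link Wilson action in 't Hooft form**:
`-(N β) S_{x}(ω^{x ← g}) = -(N β) N #{p ∋ x} + N Re tr(g B_ω)`. [folklore] -/
theorem thooft_wilsonBoundaryAction_update (β : ℝ) (x : ZdEdge d)
    (ω : LGConfig d (Matrix.specialUnitaryGroup (Fin N) ℂ)) (g : Matrix.specialUnitaryGroup (Fin N) ℂ) :
    -((N : ℝ) * β) * wilsonBoundaryAction (fundamentalRep (Fin N)) {x} (Function.update ω x g) =
      -((N : ℝ) * β) * ((N : ℝ) * (plaquettesTouching {x}).card) +
        (N : ℝ) * ((g : Matrix (Fin N) (Fin N) ℂ) * stapleField β x ω).trace.re := by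
  rw [wilsonBoundaryAction_singleton_update _ fundamentalRep_mem_unitaryGroup, Finset.sum_sub_distrib,
    Finset.sum_const, nsmul_eq_mul, stapleField, Matrix.mul_smul, Matrix.trace_smul, smul_eq_mul,
    Complex.re_ofReal_mul, stapleSum, Finset.mul_sum, Matrix.trace_sum, Complex.re_sum]
  simp only [fundamentalRep_apply]
  ring

/-- Tilting by `c + f` is tilting by `f` (probability measures). [folklore] -/
theorem tilted_const_add_eq {S : Type*} [MeasurableSpace S] (μ : Measure S) [IsProbabilityMeasure μ]
    (c : ℝ) (f : S → ℝ) : μ.tilted (fun s => c + f s) = μ.tilted f := by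
  have h := tilted_tilted (μ := μ) (f := fun _ => c) (integrable_const (exp c)) f
  rw [tilted_const] at h
  rw [h]
  rfl

/-- **The one-link conditional law of 't Hooft-scaled `SU(N)` lattice Yang–Mills is the tilted
Haar measure `ν_ω(dg) = Z⁻¹ exp(N Re tr(g B_ω)) dg`**, `B_ω = β ∑_{p ∋ x} T_p^x(ω)`
(Shen–Zhu–Zhu CMP 400 (2023) (1.1)–(1.2) restricted to one link). [cite: arXiv220412737, (1.1)–(1.2)] -/
theorem siteLaw_ymSpecification_thooft (β : ℝ) (x : ZdEdge d)
    (ω : LGConfig d (Matrix.specialUnitaryGroup (Fin N) ℂ)) :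
    siteLaw (ymSpecification (fundamentalRep (Fin N)) (N * β)) x ω =
      (haarProbability (Matrix.specialUnitaryGroup (Fin N) ℂ)).tilted
        fun g => (N : ℝ) * ((g : Matrix (Fin N) (Fin N) ℂ) * stapleField β x ω).trace.re := by
  haveI : SecondCountableTopology (Matrix (Fin N) (Fin N) ℂ) :=
    inferInstanceAs (SecondCountableTopology (Fin N → Fin N → ℂ))
  haveI : SecondCountableTopology (Matrix.specialUnitaryGroup (Fin N) ℂ) :=
    Topology.IsEmbedding.subtypeVal.secondCountableTopology
  rw [siteLaw_ymSpecification_eq_tilted_haar _ (continuous_fundamentalRep (Fin N))]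
  have : (fun g : Matrix.specialUnitaryGroup (Fin N) ℂ => -((N : ℝ) * β) *
      wilsonBoundaryAction (fundamentalRep (Fin N)) {x} (Function.update ω x g)) =
      fun g : Matrix.specialUnitaryGroup (Fin N) ℂ => -((N : ℝ) * β) * ((N : ℝ) * (plaquettesTouching {x}).card) +
        (N : ℝ) * ((g : Matrix (Fin N) (Fin N) ℂ) * stapleField β x ω).trace.re :=
    funext (thooft_wilsonBoundaryAction_update β x ω)
  rw [this, tilted_const_add_eq]

omit [DecidableEq (ZdEdge d)] in
/-- `g ↦ Re tr(g B)` is continuous on `SU(N)`. [folklore] -/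
theorem continuous_re_trace_su_mul (B : Matrix (Fin N) (Fin N) ℂ) :
    Continuous fun g : Matrix.specialUnitaryGroup (Fin N) ℂ =>
      ((g : Matrix (Fin N) (Fin N) ℂ) * B).trace.re :=
  Complex.continuous_re.comp ((continuous_subtype_val.matrix_mul continuous_const).matrix_trace)

omit [DecidableEq (ZdEdge d)] in
/-- `|Re tr(g B)| ≤ √N ‖B‖_F` on `SU(N)`. [folklore] -/
theorem abs_re_trace_su_mul_le (g : Matrix.specialUnitaryGroup (Fin N) ℂ) (B : Matrix (Fin N) (Fin N) ℂ) :
    |((g : Matrix (Fin N) (Fin N) ℂ) * B).trace.re| ≤ Real.sqrt N * frobNorm B := by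
  have := abs_re_trace_mul_le (g : Matrix (Fin N) (Fin N) ℂ) B
  rwa [frobNorm_su] at this

omit [DecidableEq (ZdEdge d)] in
/-- `g ↦ N Re tr(g B)` is `N ‖B‖_F`-Lipschitz for the Frobenius distance. [folklore] -/
theorem abs_re_trace_su_mul_sub_le (a b : Matrix.specialUnitaryGroup (Fin N) ℂ)
    (B : Matrix (Fin N) (Fin N) ℂ) :
    |((a : Matrix (Fin N) (Fin N) ℂ) * B).trace.re - ((b : Matrix (Fin N) (Fin N) ℂ) * B).trace.re| ≤
      suFrobDist a b * frobNorm B := by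
  rw [← Complex.sub_re, ← Matrix.trace_sub, ← sub_mul]
  exact abs_re_trace_mul_le _ _

end SUN

/-! ### The reduction of `shen_zhu_zhu` to the one-link Poincaré inequality on `SU(N)` -/

section HaarPoincare

variable {d N : ℕ}

/-- **Shen–Zhu–Zhu's theorem from the one-link Poincaré inequality.** Suppose that for `N ≥ 2`
and every `B ∈ M_N(ℂ)` with `‖B‖_op < 1/2` the probability measure
`ν_B(dg) = Z_B⁻¹ exp(N Re tr(g B)) dg` on `SU(N)` (`dg` = Haar) satisfies the Poincaré inequality
in the Lipschitz form `Var_{ν_B}(ψ) ≤ M² / (N (1/2 - ‖B‖_op))` for all `ψ` with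
`|ψ(a) - ψ(b)| ≤ M ‖a - b‖_F` (hypothesis `hLP`). Then `shen_zhu_zhu d N` holds: for `d ≥ 2` and
every 't Hooft coupling `|β| < 1/(16(d-1))`, the `SU(N)` lattice Yang–Mills DLR state at bare
coupling `N β` is unique and covariances of Lipschitz cylinder functions decay exponentially.

`hLP` is exactly the Bakry–Émery bound for the one-link measure: `SU(N)` with the bi-invariant
metric of the Hilbert–Schmidt inner product `⟨X, Y⟩ = Re tr(X Y*)` has `Ric = (N/2) g`
(Shen–Zhu–Zhu (4.8) with `α = 2`, after [AGZ10, (F.6)]); the potential `V(g) = -N Re tr(g B)` has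
`Hess V(X, X) = -N Re tr(X² g B) ≥ -N ‖B‖_op |X|²` along `t ↦ e^{tX} g` (the one-link case
`e = ē`, `|Λ| = 1` of Shen–Zhu–Zhu Lemma 4.1, where `|Re tr(Q X² Q' B)| ≤ ‖X‖_F² ‖B‖_op`); hence
`ν_B` satisfies `CD(N(1/2 - ‖B‖_op), ∞)` and the Poincaré inequality
`Var_{ν_B}(F) ≤ K⁻¹ ∫ |∇F|² dν_B` (Shen–Zhu–Zhu (4.7) ⇒ Cor. 4.4 (4.11) for `Λ_L` replaced by `{x}` with
frozen boundary, or
Bakry–Gentil–Ledoux Prop. 4.8.1), and `|∇ψ| ≤ Lip_geodesic(ψ) ≤ Lip_Frobenius(ψ) ≤ M` since chords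
are shorter than arcs. That Riemannian input is absent from Mathlib and is the hypothesis here.

Proof (the Dobrushin route named by Shen–Zhu–Zhu after Rem. 1.3, all lattice-side steps proved):
the one-link conditional law at `x` is `ν_{B_ω}` with `B_ω = β ∑_{p ∋ x} T_p^x(ω)`
(`siteLaw_ymSpecification_thooft`), `‖B_ω‖_op ≤ 2(d-1)|β| < 1/8`; changing the boundary
condition at one plaquette-neighbour `y` changes the potential by `w(g) = N Re tr(g (B_η - B_ω))`,
which is `N |β| n(x,y) ‖ω_y - η_y‖_F`-Lipschitz in `g` (`frobNorm_stapleField_sub_le`); the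
perturbation lemma `abs_integral_tilted_add_sub_le` along `ν_{(1-t)B_ω + t B_η}` (all of operator
norm `≤ 2(d-1)|β|`, where `hLP` gives the variance bound with `K = N(1/2 - 2(d-1)|β|)`) yields the
one-link Kantorovich–Rubinstein contraction with coefficient
`C(x, y) = κ_β n(x, y)`, `κ_β = |β| / (1/2 - 2(d-1)|β|)` — `N` cancels — and
`∑_y C(x, y) ≤ 6(d-1) κ_β < 1 ⟺ |β| < 1/(16(d-1))` (`sum_linkInfluence_le`), which is
Shen–Zhu–Zhu's Assumption 1.1 `K_𝒮 = N/2 - 8N|β|(d-1) > 0` on the nose; conclude by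
`shen_zhu_zhu_of_dobrushinCondition` with the Frobenius distance as weight (`R = 2√N`, `A = 1`).
[cite: arXiv220412737, Assumption 1.1, Thm. 1.2, Rem. 1.3 ff., Lemma 4.1, (4.7)–(4.8), Cor. 4.4 (4.11), Cor. 1.6 (Mass gap)] -/
theorem shen_zhu_zhu_of_haarPoincare
    (hLP : 2 ≤ N → ∀ B : Matrix (Fin N) (Fin N) ℂ, matrixOpNorm B < 1 / 2 →
      ∀ (ψ : Matrix.specialUnitaryGroup (Fin N) ℂ → ℝ) (M : ℝ), 0 ≤ M →
        (∀ a b, |ψ a - ψ b| ≤ M * suFrobDist a b) →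
        Var[ψ; (haarProbability (Matrix.specialUnitaryGroup (Fin N) ℂ)).tilted
            fun g => (N : ℝ) * ((g : Matrix (Fin N) (Fin N) ℂ) * B).trace.re] ≤
          M ^ 2 / ((N : ℝ) * (1 / 2 - matrixOpNorm B))) :
    shen_zhu_zhu d N := by
  classical
  refine shen_zhu_zhu_of_dobrushinCondition fun hd hN β hβ => ?_
  -- the constants
  have hd2 : (2 : ℝ) ≤ d := by exact_mod_cast hd
  have hd0 : (0 : ℝ) < (d : ℝ) - 1 := by linarith
  have hN0 : (0 : ℝ) < N := by exact_mod_cast (show 0 < N by omega)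
  have hd1' : 1 ≤ d := by omega
  have hN1 : 1 ≤ N := by omega
  set a : ℝ := |β| * (2 * ((d : ℝ) - 1)) with ha
  have hβ' : |β| * (16 * ((d : ℝ) - 1)) < 1 := by
    rwa [lt_div_iff₀ (by positivity)] at hβ
  have ha8 : 8 * a < 1 := by rw [ha]; linarith
  have ha0 : 0 ≤ a := by positivity
  have hK0 : 0 < 1 / 2 - a := by linarith
  set κ₁ : ℝ := |β| / (1 / 2 - a) with hκ₁
  have hκ₁0 : 0 ≤ κ₁ := div_nonneg (abs_nonneg β) hK0.le
  set K : ℝ := (N : ℝ) * (1 / 2 - a) with hK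
  have hKpos : 0 < K := mul_pos hN0 hK0
  refine ⟨suFrobDist, 2 * Real.sqrt N, 1, 6 * ((d : ℝ) - 1) * κ₁,
    fun x y => κ₁ * linkInfluence x y, suFrobDist_nonneg, suFrobDist_le, zero_le_one,
    fun a b => by rw [one_mul]; exact dist_suEntries_le_suFrobDist a b,
    fun x y => by positivity, ?_, ?_, ?_⟩
  · -- the Dobrushin constant: `6(d-1)|β| / (1/2 - 2(d-1)|β|) < 1 ⟺ 16(d-1)|β| < 1`
    rw [hκ₁, ← mul_div_assoc, div_lt_one hK0, ha]
    nlinarith [abs_nonneg β]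
  · -- row sums of the influence coefficients
    intro x
    rw [← Finset.mul_sum]
    have hsum : ∑ y ∈ linkPlaqNbr x, (linkInfluence x y : ℝ) ≤ 6 * ((d : ℝ) - 1) := by
      have h := sum_linkInfluence_le (d := d) x
      calc ∑ y ∈ linkPlaqNbr x, (linkInfluence x y : ℝ)
          = ((∑ y ∈ linkPlaqNbr x, linkInfluence x y : ℕ) : ℝ) := by push_cast; rfl
        _ ≤ ((6 * (d - 1) : ℕ) : ℝ) := by exact_mod_cast h
        _ = 6 * ((d : ℝ) - 1) := by push_cast [Nat.cast_sub hd1']; ring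
    calc κ₁ * ∑ y ∈ linkPlaqNbr x, (linkInfluence x y : ℝ) ≤ κ₁ * (6 * ((d : ℝ) - 1)) :=
          mul_le_mul_of_nonneg_left hsum hκ₁0
      _ = 6 * ((d : ℝ) - 1) * κ₁ := by ring
  · -- the one-link Kantorovich–Rubinstein contraction
    intro x y hy ω η hωη φ L hφm hφb hL hφL
    rw [siteLaw_ymSpecification_thooft β x ω, siteLaw_ymSpecification_thooft β x η]
    set Bω : Matrix (Fin N) (Fin N) ℂ := stapleField β x ω with hBω
    set Bη : Matrix (Fin N) (Fin N) ℂ := stapleField β x η with hBη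
    set f : Matrix.specialUnitaryGroup (Fin N) ℂ → ℝ := fun g => (N : ℝ) * ((g : Matrix (Fin N) (Fin N) ℂ) * Bω).trace.re with hf
    set w : Matrix.specialUnitaryGroup (Fin N) ℂ → ℝ :=
      fun g => (N : ℝ) * ((g : Matrix (Fin N) (Fin N) ℂ) * (Bη - Bω)).trace.re with hw
    have hfw : (fun g : Matrix.specialUnitaryGroup (Fin N) ℂ => (N : ℝ) * ((g : Matrix (Fin N) (Fin N) ℂ) * Bη).trace.re) =
        fun g => f g + w g := by
      funext g
      simp only [hf, hw, Matrix.mul_sub, Matrix.trace_sub, Complex.sub_re]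
      ring
    rw [hfw, abs_sub_comm]
    -- the Lipschitz constant of the perturbation `w`
    set D : ℝ := (N : ℝ) * (|β| * linkInfluence x y * suFrobDist (ω y) (η y)) with hD
    have hD0 : 0 ≤ D := mul_nonneg hN0.le
      (mul_nonneg (mul_nonneg (abs_nonneg β) (Nat.cast_nonneg _)) (suFrobDist_nonneg _ _))
    have hBdiff : frobNorm (Bη - Bω) ≤ |β| * linkInfluence x y * suFrobDist (ω y) (η y) := by
      rw [frobNorm_sub_comm]
      exact frobNorm_stapleField_sub_le β x y hωη
    have hwD : ∀ a b, |w a - w b| ≤ D * suFrobDist a b := fun a b => by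
      simp only [hw]
      rw [← mul_sub, abs_mul, abs_of_nonneg hN0.le, hD, mul_assoc]
      refine mul_le_mul_of_nonneg_left ?_ hN0.le
      calc |((a : Matrix (Fin N) (Fin N) ℂ) * (Bη - Bω)).trace.re - ((b : Matrix (Fin N) (Fin N) ℂ) * (Bη - Bω)).trace.re|
          ≤ suFrobDist a b * frobNorm (Bη - Bω) := abs_re_trace_su_mul_sub_le a b _
        _ ≤ suFrobDist a b * (|β| * linkInfluence x y * suFrobDist (ω y) (η y)) :=
            mul_le_mul_of_nonneg_left hBdiff (suFrobDist_nonneg _ _)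
        _ = |β| * linkInfluence x y * suFrobDist (ω y) (η y) * suFrobDist a b := by ring
    -- measurability and bounds
    have hfm : Measurable f := (continuous_const.mul (continuous_re_trace_su_mul Bω)).measurable
    have hwm : Measurable w :=
      (continuous_const.mul (continuous_re_trace_su_mul (Bη - Bω))).measurable
    have hfb : ∃ C, ∀ s, |f s| ≤ C := ⟨(N : ℝ) * (Real.sqrt N * frobNorm Bω), fun s => by
      simp only [hf]
      rw [abs_mul, abs_of_nonneg hN0.le]
      exact mul_le_mul_of_nonneg_left (abs_re_trace_su_mul_le s Bω) hN0.le⟩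
    have hwb : ∀ s, |w s| ≤ (N : ℝ) * (Real.sqrt N * frobNorm (Bη - Bω)) := fun s => by
      simp only [hw]
      rw [abs_mul, abs_of_nonneg hN0.le]
      exact mul_le_mul_of_nonneg_left (abs_re_trace_su_mul_le s _) hN0.le
    -- the perturbation lemma along the interpolating tilts
    have key := abs_integral_tilted_add_sub_le (μ := haarProbability (Matrix.specialUnitaryGroup (Fin N) ℂ))
      (r := suFrobDist) hfm hfb hwm hwb hφm hφb hKpos hL hD0 hφL hwD ?_
    · refine key.trans (le_of_eq ?_)
      rw [hD, hK, hκ₁]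
      field_simp
    · -- the uniform Poincaré bound along the interpolation, supplied by `hLP`
      intro t ht ψ M hψm _hψb hM hψL
      set Bt : Matrix (Fin N) (Fin N) ℂ := Bω + (t : ℂ) • (Bη - Bω) with hBt
      have hft : (fun u : Matrix.specialUnitaryGroup (Fin N) ℂ => f u + t * w u) =
          fun g : Matrix.specialUnitaryGroup (Fin N) ℂ => (N : ℝ) * ((g : Matrix (Fin N) (Fin N) ℂ) * Bt).trace.re := by
        funext g
        simp only [hf, hw, hBt, Matrix.mul_add, Matrix.mul_smul, Matrix.trace_add,
          Matrix.trace_smul, Complex.add_re, smul_eq_mul, Complex.re_ofReal_mul]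
        ring
      have hBt_le : matrixOpNorm Bt ≤ a := by
        have h1 : Bt = ((1 - t : ℝ) : ℂ) • Bω + ((t : ℝ) : ℂ) • Bη := by
          rw [hBt]
          push_cast
          simp only [smul_sub, sub_smul, one_smul]
          abel
        rw [h1]
        calc matrixOpNorm (((1 - t : ℝ) : ℂ) • Bω + ((t : ℝ) : ℂ) • Bη)
            ≤ matrixOpNorm (((1 - t : ℝ) : ℂ) • Bω) + matrixOpNorm (((t : ℝ) : ℂ) • Bη) :=
              matrixOpNorm_add_le _ _
          _ = (1 - t) * matrixOpNorm Bω + t * matrixOpNorm Bη := by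
              rw [matrixOpNorm_smul, matrixOpNorm_smul, Complex.norm_real, Complex.norm_real,
                Real.norm_eq_abs, Real.norm_eq_abs, abs_of_nonneg (by linarith [ht.2]),
                abs_of_nonneg ht.1]
          _ ≤ (1 - t) * a + t * a :=
              add_le_add
                (mul_le_mul_of_nonneg_left (matrixOpNorm_stapleField_le hd1' hN1 β x ω)
                  (by linarith [ht.2]))
                (mul_le_mul_of_nonneg_left (matrixOpNorm_stapleField_le hd1' hN1 β x η) ht.1)
          _ = a := by ring
      have hBt_lt : matrixOpNorm Bt < 1 / 2 := by linarith
      have hvar := hLP hN Bt hBt_lt ψ M hM hψL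
      rw [← hft, variance_eq_integral hψm.aemeasurable] at hvar
      refine hvar.trans ?_
      rw [hK]
      refine div_le_div_of_nonneg_left (sq_nonneg M) hKpos ?_
      exact mul_le_mul_of_nonneg_left (by linarith) hN0.le

end HaarPoincare

end Literature.MathematicalPhysics.QuantumFieldTheory
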